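import Mathlib.AlgebraicTopology.FundamentalGroupoid.FundamentalGroup
import Literature.Topology.FourManifolds.LickorishTwistSurgery
import Literature.Topology.FourManifolds.Cobordism
import Literature.AlgebraicTopology.FundamentalGroup.VanKampenEpi
import Literature.AlgebraicTopology.FundamentalGroup.InclHomTransport
import Literature.AlgebraicTopology.FundamentalGroup.CircleAndTorus
import HarnessLib

/-!
# Stub `stub_seamDictionary` of line `jaco-splitting-homomorphism` for crux `CongruenceShadows.WaldhausenPairs`
(item stmt-SmoothPoincare4-14592, route route-SmoothPoincare4-CongruenceShadows)

The **seam dictionary** of an explicit boundary gluing `Y = H₁ ∪_f H₂` of two `3`-manifolds with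
boundary (`IsBoundaryGluingWith b₁ b₂ f (𝓡 3) j₁ j₂`: smooth embeddings `j₁ : H₁ → Y`,
`j₂ : H₂ → Y` covering `Y` and meeting exactly along `∂H₁ ≡_f ∂H₂`, i.e.
`j₁ a = j₂ c ↔ ∃ z, a = incl₁ z ∧ c = incl₂ (f z)`).  For a base point `x ∈ ∂H₁`:

* the map `z ↦ j₁ (incl₁ z) : ∂H₁ → Y` is a topological embedding (composite of two embeddings)
  whose image is exactly the Heegaard surface `Σ = j₁(H₁) ∩ j₂(H₂)` (the seam relation), whence a
  homeomorphism `η : ∂H₁ ≃ₜ Σ` and the induced isomorphism `θ = η_* : π₁(∂H₁, x) ≅ π₁(Σ, j₁ (incl₁ x))`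
  (Hatcher, *Algebraic Topology* (2002), Prop. 1.18);
* `θ` carries `ker π₁(incl₁)` onto `ker (π₁ Σ → π₁ j₁(H₁))`: the square
  `(Σ ⊆ j₁H₁) ∘ η = j₁ ∘ incl₁` commutes and `j₁ : H₁ ≅ j₁(H₁)` is a homeomorphism onto its image,
  so both vertical maps of the induced square on `π₁` are isomorphisms (functoriality, Hatcher §1.1
  p. 34);
* `θ` carries `ker π₁(incl₂ ∘ f)` onto `ker (π₁ Σ → π₁ j₂(H₂))`: the same with `j₂ : H₂ ≅ j₂(H₂)` and
  the seam identity `j₂ ∘ incl₂ ∘ f = j₁ ∘ incl₁` (`IsBoundaryGluingWith.apply_incl`).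

No handlebody hypothesis and no smoothness beyond "smooth embeddings are topological embeddings" is
used.  This is the registered stub `stub_seamDictionary` (S2a) of the checked skeleton of the line;
its consumer is the glue `vanKampenPairQuotient_of` there.  All of it is standard algebraic
topology. [folklore]
-/

-- the prescribed namespace `Summit.<P>.<Sub>.…` duplicates `SmoothPoincare4` (P = Sub)
set_option linter.dupNamespace false
noncomputable section
open scoped Manifold ContDiff Topology
open Set Function Subgroup Literature.Topology.FourManifolds
open Literature.AlgebraicTopology.FundamentalGroup (fundamentalGroupEquivOfHomeomorph)
open Literature.AlgebraicTopology.FundamentalGroup.VanKampen (inclHomOfSubset inclHom)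

namespace Summit.SmoothPoincare4.SmoothPoincare4.Theorems.WaldhausenPairs.JacoSplittingHomomorphism

section Helpers

/-- **Kernels along a commuting square of groups.**  If `ψ ∘ θ = θ' ∘ φ` with `θ` an isomorphism
and `θ'` an isomorphism (injectivity is what is used), then `θ` maps `ker φ` onto `ker ψ`. [folklore] -/
private theorem map_ker_eq_ker_of_comm {A B C D : Type*} [Group A] [Group B] [Group C] [Group D]
    (φ : A →* C) (ψ : B →* D) (θ : A ≃* B) (θ' : C ≃* D) (h : ∀ a, ψ (θ a) = θ' (φ a)) :
    (φ.ker).map θ.toMonoidHom = ψ.ker := by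
  ext b
  simp only [Subgroup.mem_map, MonoidHom.mem_ker, MulEquiv.coe_toMonoidHom]
  constructor
  · rintro ⟨a, ha, rfl⟩
    rw [h, ha, map_one]
  · intro hb
    refine ⟨θ.symm b, θ'.injective ?_, θ.apply_symm_apply b⟩
    rw [← h, θ.apply_symm_apply, hb, map_one]

/-- **The kernel of `π₁(i)` read on an embedded copy.**  Let `i : F → M` be continuous,
`e : M → Y` a topological embedding, `S ⊆ range e`, and `η : F ≃ₜ ↥S` a homeomorphism lying over
`e ∘ i` (`↑(η z) = e (i z)`).  Then the isomorphism `η_* : π₁(F, x) ≅ π₁(↥S, η x)` carries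
`ker π₁(i)` onto the kernel of the map `π₁(↥S) → π₁(↥(range e))` induced by the inclusion:
the square `(S ⊆ range e) ∘ η = e ∘ i` commutes, and on `π₁` its vertical maps `η_*` and
`e_* : π₁(M) ≅ π₁(↥(range e))` are isomorphisms (Hatcher, *Algebraic Topology* (2002), §1.1
(p. 34) and Prop. 1.18). [folklore] -/
private theorem map_ker_eq_ker_inclHomOfSubset {F M Y : Type*} [TopologicalSpace F]
    [TopologicalSpace M] [TopologicalSpace Y] (i : C(F, M)) {e : M → Y}
    (he : Topology.IsEmbedding e) {S : Set Y} (hS : S ⊆ range e) (η : F ≃ₜ ↥S)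
    (hη : ∀ z, (η z : Y) = e (i z)) (x : F) {y : Y} (hy : y ∈ S) (hx : η x = ⟨y, hy⟩) :
    ((FundamentalGroup.map i x).ker).map (fundamentalGroupEquivOfHomeomorph η hx).toMonoidHom =
      (inclHomOfSubset hS y hy (hS hy)).ker := by
  have hbase : he.toHomeomorph (i x) = ⟨y, hS hy⟩ :=
    Subtype.ext ((hη x).symm.trans (congrArg Subtype.val hx))
  refine map_ker_eq_ker_of_comm _ _ _ (fundamentalGroupEquivOfHomeomorph he.toHomeomorph hbase)
    fun a => ?_
  rw [Literature.AlgebraicTopology.FundamentalGroup.fundamentalGroupEquivOfHomeomorph_apply,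
    Literature.AlgebraicTopology.FundamentalGroup.fundamentalGroupEquivOfHomeomorph_apply,
    FundamentalGroup.map_eq_mapOfEq]
  induction a using Quotient.ind with
  | _ γ =>
    rw [inclHomOfSubset, FundamentalGroup.mapOfEq_apply, FundamentalGroup.mapOfEq_apply,
      FundamentalGroup.mapOfEq_apply, FundamentalGroup.mapOfEq_apply]
    exact congrArg (fun p => FundamentalGroup.fromPath (Path.Homotopic.Quotient.mk p))
      (Path.ext (funext fun t => Subtype.ext (hη (γ t))))

end Helpers

/-- **The seam dictionary** (stub S2a of line `jaco-splitting-homomorphism`): for an explicit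
boundary gluing `Y = H₁ ∪_f H₂` (pieces `j₁`, `j₂`; NO handlebody hypothesis) and a base point
`x ∈ ∂H₁`, the Heegaard surface `Σ = j₁(H₁) ∩ j₂(H₂) ⊂ Y` is the homeomorphic image of `∂H₁` under
`j₁ ∘ incl₁` (seam relation `IsBoundaryGluingWith.apply_eq_apply_iff`), and the induced
isomorphism `θ : π₁(∂H₁, x) ≅ π₁(Σ, j₁ (incl₁ x))` carries the ABSTRACT kernel pair
`(ker π₁(incl₁), ker π₁(incl₂ ∘ f))` onto the SUBSPACE kernel pair
`(ker π₁(Σ ⊆ j₁H₁), ker π₁(Σ ⊆ j₂H₂))` — because `j₁ : H₁ ≅ j₁(H₁)`, `j₂ : H₂ ≅ j₂(H₂)` are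
homeomorphisms onto their images and `j₂ ∘ incl₂ ∘ f = j₁ ∘ incl₁` on `∂H₁`.  The membership `hx`
is a hypothesis only to keep the statement free of proof terms (it always holds).
Hatcher, *Algebraic Topology* (2002), Prop. 1.18 and §1.1 (p. 34). [folklore] -/
theorem stub_seamDictionary :
    ∀ (H₁ : Type) [TopologicalSpace H₁] [ChartedSpace (EuclideanHalfSpace 3) H₁] [IsManifold (𝓡∂ 3) ∞ H₁]
      (H₂ : Type) [TopologicalSpace H₂] [ChartedSpace (EuclideanHalfSpace 3) H₂] [IsManifold (𝓡∂ 3) ∞ H₂]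
      (b₁ : BoundaryData (𝓡∂ 3) H₁ (𝓡 2)) (b₂ : BoundaryData (𝓡∂ 3) H₂ (𝓡 2))
      (f : b₁.carrier ≃ₘ⟮𝓡 2, 𝓡 2⟯ b₂.carrier)
      (Y : Type) [TopologicalSpace Y] [ChartedSpace (EuclideanSpace ℝ (Fin 3)) Y]
      (j₁ : H₁ → Y) (j₂ : H₂ → Y) (_ : IsBoundaryGluingWith b₁ b₂ f (𝓡 3) j₁ j₂)
      (x : b₁.carrier) (hx : j₁ (b₁.incl x) ∈ range j₁ ∩ range j₂),
      ∃ θ : FundamentalGroup b₁.carrier x ≃*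
          FundamentalGroup ↥(range j₁ ∩ range j₂) ⟨j₁ (b₁.incl x), hx⟩,
        ((FundamentalGroup.map ⟨b₁.incl, b₁.continuous_incl⟩ x).ker).map θ.toMonoidHom =
          (inclHomOfSubset (inter_subset_left : range j₁ ∩ range j₂ ⊆ range j₁)
            (j₁ (b₁.incl x)) hx hx.1).ker ∧
        ((FundamentalGroup.map ⟨b₂.incl ∘ f, b₂.continuous_incl.comp f.continuous⟩ x).ker).map
            θ.toMonoidHom =
          (inclHomOfSubset (inter_subset_right : range j₁ ∩ range j₂ ⊆ range j₂)
            (j₁ (b₁.incl x)) hx hx.2).ker := by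
  intro H₁ _ _ _ H₂ _ _ _ b₁ b₂ f Y _ _ j₁ j₂ hj x hx
  -- `j₁ ∘ incl₁ : ∂H₁ → Y` is an embedding with image the seam `Σ = j₁(H₁) ∩ j₂(H₂)`
  have he : Topology.IsEmbedding (fun z => j₁ (b₁.incl z)) :=
    hj.isSmoothEmbedding_left.isEmbedding.comp b₁.isSmoothEmbedding.isEmbedding
  have hrange : range (fun z => j₁ (b₁.incl z)) = range j₁ ∩ range j₂ := by
    ext y
    constructor
    · rintro ⟨z, rfl⟩
      exact ⟨mem_range_self _, b₂.incl (f z), (hj.apply_incl z).symm⟩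
    · rintro ⟨⟨a, rfl⟩, c, hc⟩
      obtain ⟨z, rfl, -⟩ := (hj.apply_eq_apply_iff a c).1 hc.symm
      exact ⟨z, rfl⟩
  let η : b₁.carrier ≃ₜ ↥(range j₁ ∩ range j₂) :=
    he.toHomeomorph.trans (Homeomorph.setCongr hrange)
  have hη₁ : ∀ z, (η z : Y) = j₁ ((⟨b₁.incl, b₁.continuous_incl⟩ : C(b₁.carrier, H₁)) z) :=
    fun z => rfl
  have hη₂ : ∀ z, (η z : Y) =
      j₂ ((⟨b₂.incl ∘ f, b₂.continuous_incl.comp f.continuous⟩ : C(b₁.carrier, H₂)) z) :=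
    fun z => hj.apply_incl z
  have hηx : η x = ⟨j₁ (b₁.incl x), hx⟩ := rfl
  exact ⟨fundamentalGroupEquivOfHomeomorph η hηx,
    map_ker_eq_ker_inclHomOfSubset _ hj.isSmoothEmbedding_left.isEmbedding inter_subset_left η hη₁
      x hx hηx,
    map_ker_eq_ker_inclHomOfSubset _ hj.isSmoothEmbedding_right.isEmbedding inter_subset_right η
      hη₂ x hx hηx⟩

end Summit.SmoothPoincare4.SmoothPoincare4.Theorems.WaldhausenPairs.JacoSplittingHomomorphism
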